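/-
Copyright: the b2b-balaban T⁴-continuum CRUX team, row NE7b OWNER lineage `t4-ne7b-p1` (gen 139). Project licence.
-/
import Summits.QuantumFields.BalabanUV.T4Continuum.Spine.NE7b.SupBlockLocality
import Mathlib.Analysis.Calculus.MeanValue

/-!
# THE FIRST-ORDER KERNEL LETTERS OF THE BLOCK CLASS (SCOPING (d10)(2), discharging (449)∕(450)'s input letters): for `U ∈ C²` on `ℝ^ι`
# (`HasFDerivAt U′ (U″ φ) φ`) with an ENTRYWISE UNIFORM MAJORANT of the Hessian kernel, `|U″(φ)[e_z][e_x]| ≤ Hk_{xz}` for all `φ`, the mean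
# value theorem along `s ↦ φ + s•e_z` gives the three first-order letters consumed by (449)∕(450):
#   cross `|(U′(φ+re_z) − U′(φ))(e_x)| ≤ Hk_{xz}|r|`,  ceiling (`z = x`, `κd = Hk_{xx}`),  floor `−Hk_{xx}·r² ≤ (U′(φ+re_x) − U′(φ))(e_x)·r`;
# and for (427)'s `Y`-LOCAL block class with `‖U″‖ ≤ κ₂` the majorant is `Hk_{xz} = κ₂·[x ∈ Y][z ∈ Y]` ((412)'s locality kills off-`Y`
# directions), with row and column letters `≤ (|Y|+1)κ₂` for (449)'s `Hd` — every letter independent of the background and of the volume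
# (row NE7b, node U5c; (412) BY NAME + Mathlib's `Convex.norm_image_sub_le_of_norm_hasDerivWithin_le`; [folklore])

Cell `pub-balaban`, sub-cell `t4`, spine estimate NE7b (`T4WeightBudget.RelWeightBound`; the cell's OWN estimate — NOT PRINTED in
[Bałaban 1983–89], NOT PROVED).  Crux-route work under `Spine/NE7b/` by the row OWNER (`t4-ne7b-p1` gen 139, file (451)) under FREEZE
(0)'s crux-prover clause; NOTHING of Bałaban's is named as a Lean object, valued or asserted; no `T4Continuum/Support` leaf typed; no
`def`, no notation; zero `sorry`.  Imports (BY NAME): (412) `…SupBlockLocality` (`blockHess_apply_eq_zero_off`); Mathlib.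

WHAT IS PROVED ([folklore]; `U′ : E → E →L ℝ`, `U″ : E → E →L E →L ℝ`, `E = EuclideanSpace ℝ ι`, `e_x = EuclideanSpace.single x 1`):
* §1 `line_clm_hasDerivAt` (`s ↦ U′(φ + s•e_z)(e_x)` has derivative `U″(φ + s•e_z)(e_z)(e_x)`), **`first_order_cross`**, **`first_order_ceiling`**,
  **`first_order_floor`** — the hypotheses `hUcross`, `hUceil`, `hUfloor` of (449)∕(450) from `|U″(φ)[e_z][e_x]| ≤ Hk_{xz}` (`κd = lam = Hk_{xx}`-bound).
* §2 the block class: `block_kernel_majorant` (`‖U″‖ ≤ κ₂`, `Y`-local ⟹ `|U″(φ)[e_z][e_x]| ≤ κ₂·[x∈Y][z∈Y]`), `block_Hd_pointwise`,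
  `indicator_sum_eq`, `block_Hd_rowsum_le`, `block_Hd_colsum_le` (`Σ_w Hd_{xw}, Σ_x Hd_{xw} ≤ (|Y|+1)κ₂` for `Hd_{xw} = κ₂` at `w = x`, the majorant off it).
* §3 toy (kernel): `‖e_x‖ = 1`.

HONEST (what this is NOT).  Letters only; the row-diagonal dominance of the precision and the moment letters of (449)∕(450) are NOT touched;
for several blocks `U = Σ_BU_B` the same majorant is `κ₂·[x, z in one block]` (row letter `(n+1)κ₂`, volume-uniform) — stated for one block
here.  Scalar skeleton ((A3), NC-NE7b-α UNRULED); nothing of Bałaban's asserted.  BY-NAME EFFECT ON THE WALL: NONE.  NE7b NOT PRINTED ∕ NOT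
PROVED; spine PROVED 0∕9; rung (B)+1 — the programme's measures remain FINITE-torus statements; NOT the mass gap, NOT Clay.  HONEST
DEPENDENCY: continuum YM on T⁴ ⇐ BetaPertH ∧ nine spine estimates (0∕9 proved); BetaPertH ⇐ (D1) ∧ (D4) ∧ CAP+tail; G-an2-4 gates asym,
D1 and NE2∕3∕4.
-/

set_option autoImplicit false
set_option maxSynthPendingDepth 3

noncomputable section

namespace Summit.QuantumFields.BalabanUV.T4Continuum.NE7b.SupBlockFirstOrderLetters

open Real Set Finset
open scoped BigOperators
open SupBlockLocality (blockHess_apply_eq_zero_off)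

variable {ι : Type} [Fintype ι] [DecidableEq ι]

variable {U : EuclideanSpace ℝ ι → ℝ} {U' : EuclideanSpace ℝ ι → EuclideanSpace ℝ ι →L[ℝ] ℝ}
  {U'' : EuclideanSpace ℝ ι → EuclideanSpace ℝ ι →L[ℝ] EuclideanSpace ℝ ι →L[ℝ] ℝ} {Hk : ι → ι → ℝ} {κ₂ : ℝ}

/-! ## §1. First-order letters from an entrywise Hessian majorant -/

omit [DecidableEq ι] in
/-- **The derivative along a coordinate line, evaluated**: `s ↦ U′(φ + s•v)(w)` has derivative `U″(φ + s•v)(v)(w)`. [folklore] -/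
theorem line_clm_hasDerivAt (hU'd : ∀ φ : EuclideanSpace ℝ ι, HasFDerivAt U' (U'' φ) φ) (φ v w : EuclideanSpace ℝ ι) (s : ℝ) :
    HasDerivAt (fun s : ℝ => U' (φ + s • v) w) (U'' (φ + s • v) v w) s := by
  have hl : HasDerivAt (fun s : ℝ => φ + s • v) v s := by
    simpa using ((hasDerivAt_id s).smul_const v).const_add φ
  have hc : HasDerivAt (fun s : ℝ => U' (φ + s • v)) (U'' (φ + s • v) v) s := (hU'd (φ + s • v)).comp_hasDerivAt s hl
  have h := hc.clm_apply (hasDerivAt_const s w)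
  simpa using h

/-- **THE CROSS LETTER** (hypothesis `hUcross` of (449)∕(450)): `|U″(φ)[e_z][e_x]| ≤ Hk_{xz}` for all `φ` ⟹
`|(U′(φ + r•e_z) − U′(φ))(e_x)| ≤ Hk_{xz}·|r|` (mean value theorem along the line). [folklore] -/
theorem first_order_cross (hU'd : ∀ φ : EuclideanSpace ℝ ι, HasFDerivAt U' (U'' φ) φ)
    (hHk : ∀ (φ : EuclideanSpace ℝ ι) (x z : ι), |U'' φ (EuclideanSpace.single z (1 : ℝ)) (EuclideanSpace.single x (1 : ℝ))| ≤ Hk x z)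
    (x z : ι) (φ : EuclideanSpace ℝ ι) (r : ℝ) :
    |U' (φ + r • EuclideanSpace.single z (1 : ℝ)) (EuclideanSpace.single x (1 : ℝ)) - U' φ (EuclideanSpace.single x (1 : ℝ))| ≤ Hk x z * |r| := by
  have hd : ∀ s ∈ (univ : Set ℝ), HasDerivWithinAt (fun s : ℝ => U' (φ + s • EuclideanSpace.single z (1 : ℝ)) (EuclideanSpace.single x (1 : ℝ)))
      (U'' (φ + s • EuclideanSpace.single z (1 : ℝ)) (EuclideanSpace.single z (1 : ℝ)) (EuclideanSpace.single x (1 : ℝ))) univ s :=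
    fun s _ => (line_clm_hasDerivAt hU'd φ _ _ s).hasDerivWithinAt
  have hb : ∀ s ∈ (univ : Set ℝ), ‖U'' (φ + s • EuclideanSpace.single z (1 : ℝ)) (EuclideanSpace.single z (1 : ℝ)) (EuclideanSpace.single x (1 : ℝ))‖
      ≤ Hk x z := fun s _ => by rw [Real.norm_eq_abs]; exact hHk _ x z
  have h := convex_univ.norm_image_sub_le_of_norm_hasDerivWithin_le hd hb (mem_univ 0) (mem_univ r)
  simp only [zero_smul, add_zero, sub_zero, Real.norm_eq_abs] at h
  exact h

/-- **THE DIAGONAL CEILING** (hypothesis `hUceil`): `|(U′(φ + r•e_x) − U′(φ))(e_x)| ≤ Hk_{xx}·|r| ≤ κd·|r|` when `Hk_{xx} ≤ κd`. [folklore] -/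
theorem first_order_ceiling (hU'd : ∀ φ : EuclideanSpace ℝ ι, HasFDerivAt U' (U'' φ) φ)
    (hHk : ∀ (φ : EuclideanSpace ℝ ι) (x z : ι), |U'' φ (EuclideanSpace.single z (1 : ℝ)) (EuclideanSpace.single x (1 : ℝ))| ≤ Hk x z) {κd : ℝ}
    (hκd : ∀ x, Hk x x ≤ κd) (x : ι) (φ : EuclideanSpace ℝ ι) (r : ℝ) :
    |U' (φ + r • EuclideanSpace.single x (1 : ℝ)) (EuclideanSpace.single x (1 : ℝ)) - U' φ (EuclideanSpace.single x (1 : ℝ))| ≤ κd * |r| :=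
  (first_order_cross hU'd hHk x x φ r).trans (mul_le_mul_of_nonneg_right (hκd x) (abs_nonneg r))

/-- **THE DIAGONAL FLOOR** (hypothesis `hUfloor`, `lam = κd`): `−κd·r² ≤ (U′(φ + r•e_x) − U′(φ))(e_x)·r`. [folklore] -/
theorem first_order_floor (hU'd : ∀ φ : EuclideanSpace ℝ ι, HasFDerivAt U' (U'' φ) φ)
    (hHk : ∀ (φ : EuclideanSpace ℝ ι) (x z : ι), |U'' φ (EuclideanSpace.single z (1 : ℝ)) (EuclideanSpace.single x (1 : ℝ))| ≤ Hk x z) {κd : ℝ}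
    (hκd : ∀ x, Hk x x ≤ κd) (x : ι) (φ : EuclideanSpace ℝ ι) (r : ℝ) :
    -κd * r ^ 2 ≤ (U' (φ + r • EuclideanSpace.single x (1 : ℝ)) (EuclideanSpace.single x (1 : ℝ)) - U' φ (EuclideanSpace.single x (1 : ℝ))) * r := by
  have h := first_order_ceiling hU'd hHk hκd x φ r
  have h1 := neg_abs_le ((U' (φ + r • EuclideanSpace.single x (1 : ℝ)) (EuclideanSpace.single x (1 : ℝ)) - U' φ (EuclideanSpace.single x (1 : ℝ))) * r)
  rw [abs_mul] at h1
  have h2 : |U' (φ + r • EuclideanSpace.single x (1 : ℝ)) (EuclideanSpace.single x (1 : ℝ)) - U' φ (EuclideanSpace.single x (1 : ℝ))| * |r| ≤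
      κd * |r| * |r| := mul_le_mul_of_nonneg_right h (abs_nonneg r)
  rw [mul_assoc, abs_mul_abs_self] at h2
  nlinarith [h1, h2, sq_abs r]

/-! ## §2. The block class: the majorant `κ₂·[x ∈ Y][z ∈ Y]` and its letters -/

/-- **THE BLOCK MAJORANT**: `‖U″(φ)‖ ≤ κ₂` and `Y`-locality of `U` give `|U″(φ)[e_z][e_x]| ≤ κ₂·[x ∈ Y][z ∈ Y]`. [folklore] -/
theorem block_kernel_majorant (Y : Finset ι) (hUd : ∀ φ : EuclideanSpace ℝ ι, HasFDerivAt U (U' φ) φ)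
    (hU'd : ∀ φ : EuclideanSpace ℝ ι, HasFDerivAt U' (U'' φ) φ) (hUloc : ∀ φ φ' : EuclideanSpace ℝ ι, (∀ x ∈ Y, φ x = φ' x) → U φ = U φ')
    (hU''b : ∀ φ : EuclideanSpace ℝ ι, ‖U'' φ‖ ≤ κ₂) (φ : EuclideanSpace ℝ ι) (x z : ι) :
    |U'' φ (EuclideanSpace.single z (1 : ℝ)) (EuclideanSpace.single x (1 : ℝ))| ≤ if x ∈ Y ∧ z ∈ Y then κ₂ else 0 := by
  have hκ₂ : 0 ≤ κ₂ := (norm_nonneg _).trans (hU''b φ)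
  split_ifs with h
  · -- operator norm against unit vectors
    have h1 : ‖U'' φ (EuclideanSpace.single z (1 : ℝ)) (EuclideanSpace.single x (1 : ℝ))‖ ≤
        ‖U'' φ (EuclideanSpace.single z (1 : ℝ))‖ * ‖EuclideanSpace.single x (1 : ℝ)‖ := ContinuousLinearMap.le_opNorm _ _
    have h2 : ‖U'' φ (EuclideanSpace.single z (1 : ℝ))‖ ≤ ‖U'' φ‖ * ‖EuclideanSpace.single z (1 : ℝ)‖ := ContinuousLinearMap.le_opNorm _ _
    have hz : ‖EuclideanSpace.single z (1 : ℝ)‖ = 1 := by simp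
    have hx : ‖EuclideanSpace.single x (1 : ℝ)‖ = 1 := by simp
    rw [hz, mul_one] at h2
    rw [hx, mul_one, Real.norm_eq_abs] at h1
    exact h1.trans (h2.trans (hU''b φ))
  · -- off the block one of the two directions is supported off `Y`
    rw [not_and_or] at h
    rcases h with hx | hz
    · have hv : ∀ w ∈ Y, (EuclideanSpace.single x (1 : ℝ) : EuclideanSpace ℝ ι) w = 0 := fun w hw => by
        have hwx : w ≠ x := fun e => hx (e ▸ hw)
        simp [hwx]
      rw [(blockHess_apply_eq_zero_off Y hUd hU'd hUloc φ _ (EuclideanSpace.single z (1 : ℝ)) hv).2, abs_zero]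
    · have hv : ∀ w ∈ Y, (EuclideanSpace.single z (1 : ℝ) : EuclideanSpace ℝ ι) w = 0 := fun w hw => by
        have hwz : w ≠ z := fun e => hz (e ▸ hw)
        simp [hwz]
      rw [(blockHess_apply_eq_zero_off Y hUd hU'd hUloc φ _ (EuclideanSpace.single x (1 : ℝ)) hv).1, abs_zero]

omit [Fintype ι] in
/-- Pointwise: `Hd_{xw} ≤ κ₂·[w = x] + κ₂·[w ∈ Y]` (`κ₂ ≥ 0`). [folklore] -/
theorem block_Hd_pointwise (Y : Finset ι) (hκ₂ : 0 ≤ κ₂) (x w : ι) :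
    (if w = x then κ₂ else if x ∈ Y ∧ w ∈ Y then κ₂ else 0) ≤ (if w = x then κ₂ else 0) + (if w ∈ Y then κ₂ else 0) := by
  by_cases hwx : w = x <;> by_cases hw : w ∈ Y <;> by_cases hx : x ∈ Y <;> simp [hwx, hw, hx, hκ₂]

/-- `Σ_w (κ₂·[w = x] + κ₂·[w ∈ Y]) = (|Y| + 1)κ₂`. [folklore] -/
theorem indicator_sum_eq (Y : Finset ι) (x : ι) : ∑ w, ((if w = x then κ₂ else 0) + (if w ∈ Y then κ₂ else 0)) = (Y.card + 1) * κ₂ := by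
  rw [Finset.sum_add_distrib, Finset.sum_ite_eq' Finset.univ x, if_pos (Finset.mem_univ x), Finset.sum_ite_mem, Finset.univ_inter,
    Finset.sum_const, nsmul_eq_mul]
  ring

/-- **Row letter of `Hd`**: `Σ_w Hd_{xw} ≤ (|Y| + 1)κ₂` for `Hd_{xw} = κ₂` at `w = x` and `κ₂·[x∈Y][w∈Y]` off it (`κ₂ ≥ 0`). [folklore] -/
theorem block_Hd_rowsum_le (Y : Finset ι) (hκ₂ : 0 ≤ κ₂) (x : ι) :
    ∑ w, (if w = x then κ₂ else if x ∈ Y ∧ w ∈ Y then κ₂ else 0) ≤ (Y.card + 1) * κ₂ := by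
  rw [← indicator_sum_eq Y x]
  exact Finset.sum_le_sum fun w _ => block_Hd_pointwise Y hκ₂ x w

/-- **Column letter of `Hd`**: `Σ_x Hd_{xw} ≤ (|Y| + 1)κ₂`. [folklore] -/
theorem block_Hd_colsum_le (Y : Finset ι) (hκ₂ : 0 ≤ κ₂) (w : ι) :
    ∑ x, (if w = x then κ₂ else if x ∈ Y ∧ w ∈ Y then κ₂ else 0) ≤ (Y.card + 1) * κ₂ := by
  rw [← indicator_sum_eq Y w]
  refine Finset.sum_le_sum fun x _ => ?_
  by_cases hxw : x = w
  · subst hxw; by_cases hx : x ∈ Y <;> simp [hx, hκ₂]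
  · have hwx : ¬ w = x := fun e => hxw e.symm
    by_cases hw : w ∈ Y <;> by_cases hx : x ∈ Y <;> simp [hxw, hwx, hw, hx, hκ₂]

/-! ## §3. Toy instance (kernel) -/

/-- Toy: the coordinate directions are unit vectors, `‖e_x‖ = 1` (on `Fin 2`). -/
example : ‖(EuclideanSpace.single (0 : Fin 2) (1 : ℝ) : EuclideanSpace ℝ (Fin 2))‖ = 1 := by simp

end Summit.QuantumFields.BalabanUV.T4Continuum.NE7b.SupBlockFirstOrderLetters

end
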